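import Summits.ResolutionOfSingularities.ResolutionOfSingularities.Theorems.WeightedInvariantOrbitParametersSpan
import Summits.ResolutionOfSingularities.ResolutionOfSingularities.Theorems.WeightedInvariantGradedSimpleOrbitChartsStable
import Summits.ResolutionOfSingularities.ResolutionOfSingularities.Theorems.WeightedInvariantOrbitChartParameters
import HarnessLib

/-!
# A closed orbit with finite stabilisers is regular; homogeneous parameters stay independent along it

Route `ResolutionOfSingularities/WeightedInvariant`, door crux `HypersurfaceCentreConstruction`
(stmt-ResolutionOfSingularities-19897) — OURS, helper; e-ladder `e = 1`, registered stub `stub_e1_centre` of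
`res-L1-w43-stub-10` (cell res-hironaka, `D/res-D-pv-025/DOOR-ELADDER-PLAN.md` §7, L0-charts, item **(L0-T)**
«independence of homogeneous sections propagates along a graded-simple orbit closure», part 2 of 2; part 1 is
`Theorems/WeightedInvariantOrbitParametersSpan.lean`).

SETTING.  `Y` locally of finite type over a field `k`, `W ⊆ Y` an affine open with a `ℤʲ`-grading `𝒜` of
`Γ(Y, W)` (a torus chart), `η ∈ W` a point whose prime `𝔭_η ⊆ Γ(Y, W)` is HOMOGENEOUS with GRADED-SIMPLE quotient
(every homogeneous section outside `𝔭_η` is a unit modulo `𝔭_η`: the orbit closure `Z = closure {η}` meets `W` in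
a closed orbit with finite stabilisers).

* §1 `vanishingIdeal_closure_ideal_eq_primeIdealOf` — the reduced chart ideal of `Z` is `𝔭_η`.
* §2 **`isRegularLocalRing_stalk_quotient_orbit`: the orbit closure is a regular scheme along the chart** — for
  every `y ∈ Z ∩ W` the local ring `𝒪_{Y,y} / 𝔭_η·𝒪_{Y,y}` of the reduced orbit closure is regular.  Proof: the
  image `C = singImage 𝓘(Z)` of the non-regular locus of the reduced closed subscheme `Z` is closed (`Y` of
  finite type over a field, `isClosed_singImage`), contained in `Z`, and TORUS-STABLE on the chart: the action
  and the projection `𝔾ₘʲ × W ⇉ Y` of the grading (coaction `ρ`, `exists_coaction`) are smooth, so they pull the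
  non-regular locus back to the non-regular loci of `V(act* 𝓘(Z))`, `V(pr* 𝓘(Z))`
  (`preimage_singSet_eq_of_smooth`), and `act* 𝓘(Z) = 𝓘(act⁻¹ Z) = 𝓘(pr⁻¹ Z) = pr* 𝓘(Z)`
  (`comap_vanishingIdeal_of_smooth`; `act⁻¹ Z = pr⁻¹ Z` because `𝓘(Z)(W) = 𝔭_η` is homogeneous,
  `preimage_act_closeds_eq_of_isHomogeneous`); hence `𝓘(C)(W)` is homogeneous
  (`vanishingIdeal_isHomogeneous_of_preimage_act_eq`), and since `η ∉ C` (`𝒪_{Y,η}/𝔪_η` is a field)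
  graded-simplicity empties `C ∩ W` (`closeds_inter_eq_empty_of_gradedSimple_of_not_mem'`, res-type-047).
* §3 **`linearIndependent_toCotangent_of_mem_closure_orbit` — (L0-T)**: if moreover `Y` is regular,
  `𝒪_{Y,η}` has dimension `2`, and `g₀, g₁ ∈ 𝔭_η` are HOMOGENEOUS sections with independent differentials at
  `η`, then `g₀, g₁` have independent differentials at EVERY `y ∈ Z ∩ W`: by part 1
  (`map_primeIdealOf_eq_span_germ_of_mem_closure`, the germs at `η` span `𝔪_η` by
  `span_pair_eq_maximalIdeal_of_linearIndependent`) `(g)·𝒪_{Y,y} = 𝔭_η·𝒪_{Y,y}` has regular quotient (§2),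
  and no `gᵢ` is a multiple of the other at `y` (specialise to `η`, `stalkSpecializes`;
  `not_mem_span_image_of_linearIndependent_toCotangent`), so Matsumura 14.2
  (`linearIndependent_toCotangent_of_isRegularLocalRing_quotient`) applies.  The binder order of §3 is the one
  the stub owner asked for (res-D-pv-025, STATUS 2026-08-27T08:59:30Z (1): `hLT` of
  `isRegularWeightedCentre_ofGermFiltration`).

Def-free; no named facts; nothing here is a claim about Hironaka's problem.  AI-written; weaker than expert review.
-/

noncomputable section

set_option linter.dupNamespace false -- mandated namespace of this single-conjunct summit

open CategoryTheory AlgebraicGeometry TopologicalSpace IsLocalRing AddMonoidAlgebra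
open Literature.AlgebraicGeometry.Resolution
open Scheme.IdealSheafData (vanishingIdeal)
open Summit.ResolutionOfSingularities.ResolutionOfSingularities.Cruxes.HypersurfaceCentreConstruction.LocalEngine
  (mem_support_of_mem_singImage mem_singImage_iff_not_isRegularLocalRing_quotient)

namespace Summit.ResolutionOfSingularities.ResolutionOfSingularities.Theorems

/-! ## §1 The reduced chart ideal of an orbit closure -/

section VanishingIdeal

variable {Y : Scheme.{0}} (W : Y.affineOpens) {η : Y} (hηW : η ∈ (W : Y.Opens))

/-- **`𝓘(closure {η})(W) = 𝔭_η`**: the reduced ideal sheaf of the closure of a point `η ∈ W` has, on the affine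
chart `W`, the prime of `η` as its ideal of sections (`le_asIdeal_of_fromSpec_mem_closure`). [folklore] -/
theorem vanishingIdeal_closure_ideal_eq_primeIdealOf :
    (vanishingIdeal (⟨closure ({η} : Set Y), isClosed_closure⟩ : Closeds Y)).ideal W =
      (W.2.primeIdealOf ⟨η, hηW⟩).asIdeal := by
  ext s
  rw [Scheme.IdealSheafData.vanishingIdeal_ideal, PrimeSpectrum.mem_vanishingIdeal]
  constructor
  · intro h
    refine h (W.2.primeIdealOf ⟨η, hηW⟩) ?_
    rw [Set.mem_preimage]
    have e : W.2.fromSpec.base (W.2.primeIdealOf ⟨η, hηW⟩) = η := W.2.fromSpec_primeIdealOf ⟨η, hηW⟩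
    rw [e]
    exact subset_closure rfl
  · intro hs p hp
    exact le_asIdeal_of_fromSpec_mem_closure W hηW p hp hs

end VanishingIdeal

/-! ## §2 The orbit closure is regular along a graded-simple chart -/

section OrbitRegular

variable {k : Type} [Field k] {Y : Scheme.{0}} (f : Y ⟶ Spec (.of k)) [LocallyOfFiniteType f]
  {j : ℕ} (W : Y.affineOpens) (𝒜 : (Fin j → ℤ) → AddSubgroup Γ(Y, W)) [GradedRing 𝒜]
  {η : Y} (hηW : η ∈ (W : Y.Opens))

include f

/-- **The non-regular locus of the reduced orbit closure misses the chart.**  With `𝔭_η` homogeneous and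
graded-simple on the `ℤʲ`-graded affine chart `W` of `Y` (locally of finite type over a field), the image of the
non-regular locus of the reduced closed subscheme `closure {η}` does not meet `W`. [folklore] -/
theorem singImage_vanishingIdeal_closure_inter_eq_empty
    (hPhom : ((W.2.primeIdealOf ⟨η, hηW⟩).asIdeal).IsHomogeneous 𝒜)
    (hsimple : ∀ (d : Fin j → ℤ) (x : Γ(Y, W)), x ∈ 𝒜 d → x ∉ (W.2.primeIdealOf ⟨η, hηW⟩).asIdeal →
      IsUnit (Ideal.Quotient.mk (W.2.primeIdealOf ⟨η, hηW⟩).asIdeal x)) :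
    singImage (vanishingIdeal (⟨closure ({η} : Set Y), isClosed_closure⟩ : Closeds Y)) ∩ (W : Set Y) = ∅ := by
  classical
  haveI : IsLocallyNoetherian Y := LocallyOfFiniteType.isLocallyNoetherian f
  set Z : Closeds Y := ⟨closure ({η} : Set Y), isClosed_closure⟩ with hZdef
  set JZ := vanishingIdeal Z with hJZ
  have hZW : JZ.ideal W = (W.2.primeIdealOf ⟨η, hηW⟩).asIdeal :=
    vanishingIdeal_closure_ideal_eq_primeIdealOf W hηW
  -- the non-regular locus of the reduced orbit closure, a closed subset of `Z`
  let C : Closeds Y := ⟨singImage JZ, isClosed_singImage f JZ⟩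
  have hCZ : C ≤ Z := by
    intro y hy
    have h := mem_support_of_mem_singImage JZ hy
    have h' : y ∈ ((JZ.support : Closeds Y) : Set Y) := h
    rwa [hJZ, Scheme.IdealSheafData.coe_support_vanishingIdeal] at h'
  -- the coaction of the grading: action and projection of the torus chart
  obtain ⟨ρ, hρ⟩ := DatumToEmbedded.CentreHomogeneous.exists_coaction (M := Fin j → ℤ) 𝒜
  let L : Type := (Γ(Y, W) : Type)[Fin j → ℤ]
  let T : Scheme.{0} := Spec (.of L)
  let φa : Γ(Y, W) ⟶ CommRingCat.of L := CommRingCat.ofHom ρ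
  let φp : Γ(Y, W) ⟶ CommRingCat.of L := CommRingCat.ofHom singleZeroRingHom
  let act : T ⟶ Y := Spec.map φa ≫ W.2.fromSpec
  let pr : T ⟶ Y := Spec.map φp ≫ W.2.fromSpec
  haveI : Smooth (Spec.map φa) :=
    (HasRingHomProperty.Spec_iff (P := @Smooth)).mpr
      (DatumToEmbedded.CentreHomogeneous.smooth_coaction 𝒜 ρ hρ)
  haveI : Smooth (Spec.map φp) :=
    (HasRingHomProperty.Spec_iff (P := @Smooth)).mpr
      (DatumToEmbedded.CentreHomogeneous.smooth_singleZeroRingHom _ j)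
  haveI : Smooth act := inferInstance
  haveI : Smooth pr := inferInstance
  -- `Z` is torus-stable (its chart ideal `𝔭_η` is homogeneous), hence so is `𝓘(Z)` and its non-regular locus
  have hZpre : (act ⁻¹' (Z : Set Y)) = pr ⁻¹' (Z : Set Y) :=
    preimage_act_closeds_eq_of_isHomogeneous W 𝒜 ρ hρ Z (hZW ▸ hPhom)
  have hZpre' : Z.preimage act.continuous = Z.preimage pr.continuous := by
    apply Closeds.ext
    rw [Closeds.coe_preimage, Closeds.coe_preimage]
    exact hZpre
  have hcomap : JZ.comap act = JZ.comap pr := by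
    rw [hJZ, comap_vanishingIdeal_of_smooth act Z, comap_vanishingIdeal_of_smooth pr Z, hZpre']
  have hC : act ⁻¹' (C : Set Y) = pr ⁻¹' (C : Set Y) := by
    change act ⁻¹' singImage JZ = pr ⁻¹' singImage JZ
    simp only [singImage]
    rw [preimage_singSet_eq_of_smooth act JZ, preimage_singSet_eq_of_smooth pr JZ, hcomap]
  have hChom : ((vanishingIdeal C).ideal W).IsHomogeneous 𝒜 :=
    vanishingIdeal_isHomogeneous_of_preimage_act_eq W 𝒜 ρ hρ C hC
  -- graded-simplicity of `𝓘(Z)(W) = 𝔭_η`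
  have hP : ∀ (i : Fin j → ℤ) ⦃a : Γ(Y, W)⦄, a ∈ 𝒜 i → a ∉ (vanishingIdeal Z).ideal W →
      IsUnit (Ideal.Quotient.mk ((vanishingIdeal Z).ideal W) a) := by
    rw [← hJZ, hZW]
    exact fun i a ha hna => hsimple i a ha hna
  -- `η ∉ C`: the reduced orbit closure is regular at its generic point (`𝒪/𝔪` is a field)
  have hηZ : η ∈ Z := subset_closure rfl
  have hηsupp : η ∈ JZ.support := by
    change η ∈ ((JZ.support : Closeds Y) : Set Y)
    rw [hJZ, Scheme.IdealSheafData.coe_support_vanishingIdeal]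
    exact hηZ
  have hηC : η ∉ C := by
    intro hηC
    apply (mem_singImage_iff_not_isRegularLocalRing_quotient JZ hηsupp).mp hηC
    letI : Algebra Γ(Y, W) (Y.presheaf.stalk η) := TopCat.Presheaf.algebra_section_stalk Y.presheaf ⟨η, hηW⟩
    have hloc : IsLocalization.AtPrime (Y.presheaf.stalk η) (W.2.primeIdealOf ⟨η, hηW⟩).asIdeal :=
      W.2.isLocalization_stalk ⟨η, hηW⟩
    have hst : stalkIdeal JZ η = maximalIdeal (Y.presheaf.stalk η) := by
      rw [stalkIdeal_eq_map_germ JZ W hηW, hZW]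
      exact IsLocalization.AtPrime.map_eq_maximalIdeal (W.2.primeIdealOf ⟨η, hηW⟩).asIdeal
        (Y.presheaf.stalk η)
    rw [hst]
    letI := Ideal.Quotient.field (maximalIdeal (Y.presheaf.stalk η))
    infer_instance
  exact closeds_inter_eq_empty_of_gradedSimple_of_not_mem' W 𝒜 C Z hCZ hP hChom hηW hηZ hηC

/-- **The orbit closure is regular along the chart**: for every `y ∈ W ∩ closure {η}`, the local ring
`𝒪_{Y,y} / 𝔭_η·𝒪_{Y,y}` of the reduced orbit closure is a regular local ring (`𝔭_η` homogeneous with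
graded-simple quotient; `Y` locally of finite type over a field). [folklore] -/
theorem isRegularLocalRing_stalk_quotient_orbit
    (hPhom : ((W.2.primeIdealOf ⟨η, hηW⟩).asIdeal).IsHomogeneous 𝒜)
    (hsimple : ∀ (d : Fin j → ℤ) (x : Γ(Y, W)), x ∈ 𝒜 d → x ∉ (W.2.primeIdealOf ⟨η, hηW⟩).asIdeal →
      IsUnit (Ideal.Quotient.mk (W.2.primeIdealOf ⟨η, hηW⟩).asIdeal x))
    {y : Y} (hyW : y ∈ (W : Y.Opens)) (hyc : y ∈ closure ({η} : Set Y)) :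
    IsRegularLocalRing (Y.presheaf.stalk y ⧸
      ((W.2.primeIdealOf ⟨η, hηW⟩).asIdeal).map (Y.presheaf.germ (W : Y.Opens) y hyW).hom) := by
  set Z : Closeds Y := ⟨closure ({η} : Set Y), isClosed_closure⟩ with hZdef
  set JZ := vanishingIdeal Z with hJZ
  have hempty := singImage_vanishingIdeal_closure_inter_eq_empty f W 𝒜 hηW hPhom hsimple
  have hyC : y ∉ singImage JZ := fun h => by
    have : y ∈ singImage JZ ∩ (W : Set Y) := ⟨h, hyW⟩
    rw [hJZ, hZdef, hempty] at this
    exact this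
  have hysupp : y ∈ JZ.support := by
    change y ∈ ((JZ.support : Closeds Y) : Set Y)
    rw [hJZ, Scheme.IdealSheafData.coe_support_vanishingIdeal]
    exact hyc
  have hreg : IsRegularLocalRing (Y.presheaf.stalk y ⧸ stalkIdeal JZ y) :=
    not_not.mp ((mem_singImage_iff_not_isRegularLocalRing_quotient JZ hysupp).not.mp hyC)
  rwa [stalkIdeal_eq_map_germ JZ W hyW, hJZ, hZdef, vanishingIdeal_closure_ideal_eq_primeIdealOf W hηW] at hreg

end OrbitRegular

/-! ## §3 (L0-T): homogeneous parameters stay independent along the orbit closure -/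

section LZeroT

variable {k : Type} [Field k] {Y : Scheme.{0}} (f : Y ⟶ Spec (.of k)) [LocallyOfFiniteType f]
  (hY : Scheme.IsRegular Y)
  {j : ℕ} (W : Y.affineOpens) (𝒜 : (Fin j → ℤ) → AddSubgroup Γ(Y, W)) [GradedRing 𝒜]
  {η : Y} (hηW : η ∈ (W : Y.Opens))

include f hY in
/-- **(L0-T) Independence of homogeneous sections propagates along a graded-simple orbit closure.**  Let `Y`
be regular and locally of finite type over a field, `W ⊆ Y` an affine `ℤʲ`-graded chart, `η ∈ W` with `𝔭_η`
homogeneous and graded-simple and `dim 𝒪_{Y,η} = 2`, and `g₀, g₁ ∈ Γ(Y, W)` HOMOGENEOUS sections vanishing at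
`η` whose germs at `η` have independent differentials.  Then at every `y ∈ W ∩ closure {η}` the germs of
`g₀, g₁` have independent differentials (binder order as requested by the stub owner for `hLT`). [folklore] -/
theorem linearIndependent_toCotangent_of_mem_closure_orbit
    (hPhom : ((W.2.primeIdealOf ⟨η, hηW⟩).asIdeal).IsHomogeneous 𝒜)
    (hsimple : ∀ (d : Fin j → ℤ) (x : Γ(Y, W)), x ∈ 𝒜 d → x ∉ (W.2.primeIdealOf ⟨η, hηW⟩).asIdeal →
      IsUnit (Ideal.Quotient.mk (W.2.primeIdealOf ⟨η, hηW⟩).asIdeal x))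
    (hdim : ringKrullDim (Y.presheaf.stalk η) = ((2 : ℕ) : WithBot ℕ∞))
    (g : Fin 2 → Γ(Y, W)) (d : Fin 2 → (Fin j → ℤ)) (hgd : ∀ i, g i ∈ 𝒜 (d i))
    (_hgP : ∀ i, g i ∈ (W.2.primeIdealOf ⟨η, hηW⟩).asIdeal)
    (hgη : ∀ i, (Y.presheaf.germ (W : Y.Opens) η hηW).hom (g i) ∈ maximalIdeal (Y.presheaf.stalk η))
    (hli : LinearIndependent (ResidueField (Y.presheaf.stalk η))
      fun i => (maximalIdeal (Y.presheaf.stalk η)).toCotangent ⟨_, hgη i⟩)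
    (y : Y) (hyW : y ∈ (W : Y.Opens)) (hyc : y ∈ closure ({η} : Set Y))
    (hgy : ∀ i, (Y.presheaf.germ (W : Y.Opens) y hyW).hom (g i) ∈ maximalIdeal (Y.presheaf.stalk y)) :
    LinearIndependent (ResidueField (Y.presheaf.stalk y))
      fun i => (maximalIdeal (Y.presheaf.stalk y)).toCotangent ⟨_, hgy i⟩ := by
  haveI : IsLocallyNoetherian Y := LocallyOfFiniteType.isLocallyNoetherian f
  haveI : IsRegularLocalRing (Y.presheaf.stalk η) := hY η
  haveI : IsRegularLocalRing (Y.presheaf.stalk y) := hY y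
  -- the germs at `η` span `𝔪_η`, hence `(g)·𝒪_{Y,y} = 𝔭_η·𝒪_{Y,y}` (part 1)
  have hspan : Ideal.span (Set.range fun i => (Y.presheaf.germ (W : Y.Opens) η hηW).hom (g i)) =
      maximalIdeal (Y.presheaf.stalk η) :=
    span_pair_eq_maximalIdeal_of_linearIndependent hdim _ hgη hli
  set z : Fin 2 → Y.presheaf.stalk y := fun i => (Y.presheaf.germ (W : Y.Opens) y hyW).hom (g i) with hzdef
  have hmap : ((W.2.primeIdealOf ⟨η, hηW⟩).asIdeal).map (Y.presheaf.germ (W : Y.Opens) y hyW).hom =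
      Ideal.span (Set.range z) :=
    map_primeIdealOf_eq_span_germ_of_mem_closure W 𝒜 hηW hPhom hsimple g hgd hspan hyW hyc
  -- its quotient is regular (§2)
  haveI : IsRegularLocalRing (Y.presheaf.stalk y ⧸ Ideal.span (Set.range z)) := by
    rw [← hmap]
    exact isRegularLocalRing_stalk_quotient_orbit f W 𝒜 hηW hPhom hsimple hyW hyc
  -- minimality: no `gᵢ` is a multiple of the other at `y` (specialise to `η`)
  have hspec : η ⤳ y := specializes_iff_mem_closure.mpr hyc
  have hφ : ∀ i, (Y.presheaf.stalkSpecializes hspec).hom (z i) =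
      (Y.presheaf.germ (W : Y.Opens) η hηW).hom (g i) := fun i => by
    simp only [hzdef]
    rw [← CommRingCat.comp_apply, TopCat.Presheaf.germ_stalkSpecializes]
  have hmin : ∀ i, z i ∉ Ideal.span (z '' {i' | i' ≠ i}) := by
    intro i hi
    have hi' := Ideal.mem_map_of_mem (Y.presheaf.stalkSpecializes hspec).hom hi
    rw [Ideal.map_span, ← Set.image_comp, hφ i] at hi'
    have himg : ((fun a => (Y.presheaf.stalkSpecializes hspec).hom a) ∘ z) '' {i' | i' ≠ i} =
        (fun i => (Y.presheaf.germ (W : Y.Opens) η hηW).hom (g i)) '' {i' | i' ≠ i} :=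
      Set.image_congr fun i' _ => hφ i'
    rw [himg] at hi'
    exact not_mem_span_image_of_linearIndependent_toCotangent _ hgη hli i {i' | i' ≠ i}
      (fun h => h rfl) hi'
  exact linearIndependent_toCotangent_of_isRegularLocalRing_quotient z hgy hmin

end LZeroT

end Summit.ResolutionOfSingularities.ResolutionOfSingularities.Theorems

end
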